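import Summits.AnomalousDissipation.AnomalousDissipation.Theorems.SolenoidalFractalHomogenisationLagrangianStepPropagatorClass
import Summits.AnomalousDissipation.AnomalousDissipation.Theorems.SolenoidalFractalHomogenisationLagrangianStepCellInputsBilinearLeray
import HarnessLib

/-!
# K1L_D (stmt-AnomalousDissipation-27980), line «onelevel-design», brick Z4♭: ASSEMBLY of the slow×slow bilinear bound from MODEWISE bounds on
# single real mode pairs (helper; `--supports … --as helper`; lead-k1l-onelevel-p1 g4)

Abstract `V2` statement behind Z4♭ (memo `Cruxes/LagrangianRenormalisationStep/Lines/onelevel-L8-bilinear-cut.md` §2).  Let `U, T : V2 →L[ℝ] V2`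
(the flat window maps) see only the divergence-free projection of their argument and PRESERVE CLASS PAIRS of the grid `(n⁻¹ℤ)³` (a datum with
no coefficient on `{k ≡ c} ∪ {k ≡ −c}` is mapped to such an element — `…PropagatorClass.fcoeff_apply_eq_zero_of_classes` for both propagators of
the flat pair), and satisfy the MODEWISE bound: for every `ℓ` in the slow Finset `S` and every weakly divergence-free `v ∈ V2` with coefficients
on the pair `{ℓ, −ℓ}` only, `‖𝓕(U v − T v)(ℓ)‖ ≤ ε_ℓ · ‖𝓕v(ℓ)‖` (what (V) delivers: `…CellTimeModewise` + `…SinePhase`).  If the slow modes are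
alone in their class pairs (`k ∈ S`, `k ≡ ±ℓ (mod n)` ⇒ `k = ±ℓ`) and not self-conjugate (`¬ n ∣ 2ℓ`), then for ALL `x, y ∈ V2` with
coefficients supported on `S`:
* `fcoeff_two_smul_pairAvg` — `2•R_ℓ x` carries the coefficients of `x` on the class pair of `ℓ`, `0` elsewhere;
* **`abs_inner_sub_le_sum_of_modewise`** — `|⟪U x − T x, y⟫| ≤ Σ_{ℓ∈S} ε_ℓ ‖𝓕x(ℓ)‖ ‖𝓕y(ℓ)‖`;
* **`abs_inner_sub_le_sqrt_of_modewise`** — with `ε_ℓ ≤ η·d_ℓ`, `0 ≤ d_ℓ`: `≤ η √(Σ_S d‖𝓕x‖²) √(Σ_S d‖𝓕y‖²)` — the (BIL) shape on `S`-supported data.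
NOT a proof of Z4♭, of any registered stub, of the crux, or of AD; rung F-D1.A0.
-/

set_option linter.dupNamespace false  -- the summit-side namespace `Summit.AnomalousDissipation.AnomalousDissipation.…` repeats a component by design (D-0017)

noncomputable section

namespace Summit.AnomalousDissipation.AnomalousDissipation.Theorems.SolenoidalFractalHomogenisation.LagrangianStep.PropagatorSymm

open Literature.Analysis Literature.Analysis.FluidPDE Literature.Analysis.FluidPDE.Torus Literature.Analysis.FunctionSpaces
open MeasureTheory Set Filter UnitAddTorus Function
open scoped ENNReal NNReal InnerProductSpace
open OneLevelSplit

variable {n : ℕ}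

/-! ## Twice the pair average isolates the class pair of a non-self-conjugate frequency -/

/-- **Coefficients of `2•R_c x`** (`c` not self-conjugate mod `n`): `𝓕x(k)` on the class pair of `c`, `0` elsewhere. -/
theorem fcoeff_two_smul_pairAvg (hn : 0 < n) (c : Fin 3 → ℤ) (hc : ¬ (∀ i, (n:ℤ) ∣ c i + c i)) (x : V2) (k : Fin 3 → ℤ) :
    mFourierCoeff (EuclideanSpace.complexify ∘ ⇑((2:ℝ) • ∑ j : Fin 3 → Fin n,
        (1 / (n:ℝ) ^ 3 * Real.cos (2 * Real.pi * (∑ i, (c i : ℝ) * ((j i : ℕ) : ℝ)) / n)) •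
          Lp.compMeasurePreserving (fun y : UnitAddTorus (Fin 3) => y + (fun i => ((((j i : ℕ) : ℝ) / n : ℝ) : UnitAddCircle)))
            (measurePreserving_add_right volume _) x)) k
      = if ((∀ i, (n:ℤ) ∣ k i - c i) ∨ (∀ i, (n:ℤ) ∣ k i + c i)) then mFourierCoeff (EuclideanSpace.complexify ∘ ⇑x) k else 0 := by
  rw [fcoeff_smul, fcoeff_pairAvg, ClassReduction.multiplier_eq hn, smul_smul]
  -- not both divisibilities (else `n ∣ 2c`)
  have hnot : ¬ ((∀ i, (n:ℤ) ∣ k i + c i) ∧ (∀ i, (n:ℤ) ∣ k i - c i)) := by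
    rintro ⟨h1, h2⟩
    exact hc fun i => by have := dvd_sub (h1 i) (h2 i); rwa [show k i + c i - (k i - c i) = c i + c i by ring] at this
  by_cases h1 : ∀ i, (n:ℤ) ∣ k i - c i
  · have h2 : ¬ ∀ i, (n:ℤ) ∣ k i + c i := fun h2 => hnot ⟨h2, h1⟩
    rw [if_pos h1, if_neg h2, if_pos (Or.inl h1)]; norm_num
  · by_cases h2 : ∀ i, (n:ℤ) ∣ k i + c i
    · rw [if_neg h1, if_pos h2, if_pos (Or.inr h2)]; norm_num
    · rw [if_neg h1, if_neg h2, if_neg (not_or.2 ⟨h1, h2⟩)]; norm_num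

/-- The pair average (and any real multiple of it) of a weakly divergence-free class is weakly divergence free. -/
theorem pairAvg_mem_divFreeL2 (c : Fin 3 → ℤ) (a : ℝ) {x : V2} (hx : x ∈ divFreeL2 (Fin 3)) :
    (a • ∑ j : Fin 3 → Fin n,
        (1 / (n:ℝ) ^ 3 * Real.cos (2 * Real.pi * (∑ i, (c i : ℝ) * ((j i : ℕ) : ℝ)) / n)) •
          Lp.compMeasurePreserving (fun y : UnitAddTorus (Fin 3) => y + (fun i => ((((j i : ℕ) : ℝ) / n : ℝ) : UnitAddCircle)))
            (measurePreserving_add_right volume _) x) ∈ divFreeL2 (Fin 3) :=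
  (divFreeL2 (Fin 3)).smul_mem a ((divFreeL2 (Fin 3)).sum_mem fun _ _ => (divFreeL2 (Fin 3)).smul_mem _ (translate_mem_divFreeL2 _ hx))

/-! ## The assembly -/

variable (S : Finset (Fin 3 → ℤ)) (U T : V2 →L[ℝ] V2) (ε : (Fin 3 → ℤ) → ℝ)
  (hn : 0 < n)
  (halone : ∀ ℓ ∈ S, ∀ k ∈ S, ((∀ i, (n:ℤ) ∣ k i - ℓ i) ∨ (∀ i, (n:ℤ) ∣ k i + ℓ i)) → k = ℓ ∨ k = -ℓ)
  (hnsc : ∀ ℓ ∈ S, ¬ (∀ i, (n:ℤ) ∣ ℓ i + ℓ i))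
  (hε : ∀ ℓ, 0 ≤ ε ℓ)
  (hUP : ∀ x : V2, U x = U ((divFreeL2 (Fin 3)).starProjection x))
  (hTP : ∀ x : V2, T x = T ((divFreeL2 (Fin 3)).starProjection x))
  (hUcl : ∀ (c : Fin 3 → ℤ) (x : V2), (∀ k', ((∀ i, (n:ℤ) ∣ k' i - c i) ∨ (∀ i, (n:ℤ) ∣ k' i + c i)) →
      mFourierCoeff (EuclideanSpace.complexify ∘ ⇑x) k' = 0) →
    ∀ k, ((∀ i, (n:ℤ) ∣ k i - c i) ∨ (∀ i, (n:ℤ) ∣ k i + c i)) → mFourierCoeff (EuclideanSpace.complexify ∘ ⇑(U x)) k = 0)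
  (hTcl : ∀ (c : Fin 3 → ℤ) (x : V2), (∀ k', ((∀ i, (n:ℤ) ∣ k' i - c i) ∨ (∀ i, (n:ℤ) ∣ k' i + c i)) →
      mFourierCoeff (EuclideanSpace.complexify ∘ ⇑x) k' = 0) →
    ∀ k, ((∀ i, (n:ℤ) ∣ k i - c i) ∨ (∀ i, (n:ℤ) ∣ k i + c i)) → mFourierCoeff (EuclideanSpace.complexify ∘ ⇑(T x)) k = 0)
  (hmode : ∀ ℓ ∈ S, ∀ v : V2, v ∈ divFreeL2 (Fin 3) →
    (∀ k, k ≠ ℓ → k ≠ -ℓ → mFourierCoeff (EuclideanSpace.complexify ∘ ⇑v) k = 0) →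
    ‖mFourierCoeff (EuclideanSpace.complexify ∘ ⇑(U v - T v)) ℓ‖ ≤ ε ℓ * ‖mFourierCoeff (EuclideanSpace.complexify ∘ ⇑v) ℓ‖)

include hn halone hnsc hε hUP hTP hUcl hTcl hmode

omit hε hUP hTP in
/-- **Modewise error of a slow-supported divergence-free datum**: `‖𝓕(U x − T x)(ℓ)‖ ≤ ε_ℓ ‖𝓕x(ℓ)‖` for `ℓ ∈ S`, `x ∈ divFreeL2` supported on `S`. -/
theorem norm_fcoeff_sub_le_of_modewise {x : V2} (hx : x ∈ divFreeL2 (Fin 3))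
    (hxS : ∀ k, k ∉ S → mFourierCoeff (EuclideanSpace.complexify ∘ ⇑x) k = 0) {ℓ : Fin 3 → ℤ} (hℓ : ℓ ∈ S) :
    ‖mFourierCoeff (EuclideanSpace.complexify ∘ ⇑(U x - T x)) ℓ‖ ≤ ε ℓ * ‖mFourierCoeff (EuclideanSpace.complexify ∘ ⇑x) ℓ‖ := by
  -- the pair part `v = 2•R_ℓ x` of `x`
  set v : V2 := (2:ℝ) • ∑ j : Fin 3 → Fin n,
        (1 / (n:ℝ) ^ 3 * Real.cos (2 * Real.pi * (∑ i, (ℓ i : ℝ) * ((j i : ℕ) : ℝ)) / n)) •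
          Lp.compMeasurePreserving (fun y : UnitAddTorus (Fin 3) => y + (fun i => ((((j i : ℕ) : ℝ) / n : ℝ) : UnitAddCircle)))
            (measurePreserving_add_right volume _) x with hv_def
  have hvc : ∀ k, mFourierCoeff (EuclideanSpace.complexify ∘ ⇑v) k
      = if ((∀ i, (n:ℤ) ∣ k i - ℓ i) ∨ (∀ i, (n:ℤ) ∣ k i + ℓ i)) then mFourierCoeff (EuclideanSpace.complexify ∘ ⇑x) k else 0 :=
    fun k => fcoeff_two_smul_pairAvg hn ℓ (hnsc ℓ hℓ) x k
  have hvdiv : v ∈ divFreeL2 (Fin 3) := pairAvg_mem_divFreeL2 ℓ 2 hx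
  -- `v` is supported on `{ℓ, −ℓ}`
  have hvsupp : ∀ k, k ≠ ℓ → k ≠ -ℓ → mFourierCoeff (EuclideanSpace.complexify ∘ ⇑v) k = 0 := by
    intro k hk1 hk2
    rw [hvc]
    split_ifs with hpair
    · by_cases hkS : k ∈ S
      · rcases halone ℓ hℓ k hkS hpair with h | h
        · exact absurd h hk1
        · exact absurd h hk2
      · exact hxS k hkS
    · rfl
  have hvℓ : mFourierCoeff (EuclideanSpace.complexify ∘ ⇑v) ℓ = mFourierCoeff (EuclideanSpace.complexify ∘ ⇑x) ℓ := by
    rw [hvc, if_pos (Or.inl fun i => by simp)]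
  -- the rest `x − v` has no coefficient on the class pair of `ℓ`
  have hrest : ∀ k', ((∀ i, (n:ℤ) ∣ k' i - ℓ i) ∨ (∀ i, (n:ℤ) ∣ k' i + ℓ i)) →
      mFourierCoeff (EuclideanSpace.complexify ∘ ⇑(x - v)) k' = 0 := by
    intro k' hk'
    rw [fcoeff_sub, hvc, if_pos hk', sub_self]
  have hUr := hUcl ℓ (x - v) hrest ℓ (Or.inl fun i => by simp)
  have hTr := hTcl ℓ (x - v) hrest ℓ (Or.inl fun i => by simp)
  -- decompose
  have e : U x - T x = (U v - T v) + (U (x - v) - T (x - v)) := by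
    have ex : x = v + (x - v) := by abel
    conv_lhs => rw [ex]
    rw [map_add, map_add]; abel
  rw [e, fcoeff_add, fcoeff_sub (U (x - v)), hUr, hTr, sub_zero, add_zero, ← hvℓ]
  exact hmode ℓ hℓ v hvdiv hvsupp

/-- **ASSEMBLY**: `|⟪U x − T x, y⟫| ≤ Σ_{ℓ∈S} ε_ℓ ‖𝓕x(ℓ)‖ ‖𝓕y(ℓ)‖` for `S`-supported `x, y ∈ V2`. -/
theorem abs_inner_sub_le_sum_of_modewise (x y : V2)
    (hxS : ∀ k, k ∉ S → mFourierCoeff (EuclideanSpace.complexify ∘ ⇑x) k = 0)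
    (hyS : ∀ k, k ∉ S → mFourierCoeff (EuclideanSpace.complexify ∘ ⇑y) k = 0) :
    |⟪U x - T x, y⟫_ℝ| ≤ ∑ ℓ ∈ S, ε ℓ * ‖mFourierCoeff (EuclideanSpace.complexify ∘ ⇑x) ℓ‖ * ‖mFourierCoeff (EuclideanSpace.complexify ∘ ⇑y) ℓ‖ := by
  -- reduce to the divergence-free projection of `x`
  set x' : V2 := (divFreeL2 (Fin 3)).starProjection x with hx'
  have hx'mem : x' ∈ divFreeL2 (Fin 3) := (divFreeL2 (Fin 3)).starProjection_apply_mem x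
  have hdom : ∀ k, ‖mFourierCoeff (EuclideanSpace.complexify ∘ ⇑x') k‖ ≤ ‖mFourierCoeff (EuclideanSpace.complexify ∘ ⇑x) k‖ :=
    fun k => norm_mFourierCoeff_starProjection_le x k
  have hx'S : ∀ k, k ∉ S → mFourierCoeff (EuclideanSpace.complexify ∘ ⇑x') k = 0 := fun k hk => by
    have h := hdom k; rw [hxS k hk, norm_zero] at h; exact norm_eq_zero.1 (le_antisymm h (norm_nonneg _))
  have e0 : U x - T x = U x' - T x' := by rw [hUP x, hTP x]
  rw [e0, inner_eq_sum_of_support S (U x' - T x') y hyS]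
  refine (Finset.abs_sum_le_sum_abs _ _).trans (Finset.sum_le_sum fun ℓ hℓ => ?_)
  have h1 : |(inner ℂ (mFourierCoeff (EuclideanSpace.complexify ∘ ⇑(U x' - T x')) ℓ)
      (mFourierCoeff (EuclideanSpace.complexify ∘ ⇑y) ℓ)).re|
      ≤ ‖mFourierCoeff (EuclideanSpace.complexify ∘ ⇑(U x' - T x')) ℓ‖ * ‖mFourierCoeff (EuclideanSpace.complexify ∘ ⇑y) ℓ‖ :=
    (Complex.abs_re_le_norm _).trans (norm_inner_le_norm _ _)
  refine h1.trans ?_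
  have h2 := norm_fcoeff_sub_le_of_modewise S U T ε hn halone hnsc hUcl hTcl hmode hx'mem hx'S hℓ
  have h3 : ε ℓ * ‖mFourierCoeff (EuclideanSpace.complexify ∘ ⇑x') ℓ‖ ≤ ε ℓ * ‖mFourierCoeff (EuclideanSpace.complexify ∘ ⇑x) ℓ‖ :=
    mul_le_mul_of_nonneg_left (hdom ℓ) (hε ℓ)
  exact mul_le_mul_of_nonneg_right (h2.trans h3) (norm_nonneg _)

/-- **ASSEMBLY, (BIL) shape**: if moreover `ε_ℓ ≤ η·d_ℓ` on `S` with `0 ≤ d_ℓ` and `0 ≤ η`, then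
`|⟪U x − T x, y⟫| ≤ η √(Σ_S d‖𝓕x‖²) √(Σ_S d‖𝓕y‖²)`. -/
theorem abs_inner_sub_le_sqrt_of_modewise (d : (Fin 3 → ℤ) → ℝ) (η : ℝ) (hη : 0 ≤ η) (hd0 : ∀ k, 0 ≤ d k)
    (hεd : ∀ ℓ ∈ S, ε ℓ ≤ η * d ℓ) (x y : V2)
    (hxS : ∀ k, k ∉ S → mFourierCoeff (EuclideanSpace.complexify ∘ ⇑x) k = 0)
    (hyS : ∀ k, k ∉ S → mFourierCoeff (EuclideanSpace.complexify ∘ ⇑y) k = 0) :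
    |⟪U x - T x, y⟫_ℝ| ≤ η
      * Real.sqrt (∑ k ∈ S, d k * ‖mFourierCoeff (EuclideanSpace.complexify ∘ ⇑x) k‖ ^ 2)
      * Real.sqrt (∑ k ∈ S, d k * ‖mFourierCoeff (EuclideanSpace.complexify ∘ ⇑y) k‖ ^ 2) := by
  refine (abs_inner_sub_le_sum_of_modewise S U T ε hn halone hnsc hε hUP hTP hUcl hTcl hmode x y hxS hyS).trans ?_
  -- `Σ ε|x̂||ŷ| ≤ η Σ d |x̂||ŷ| = η Σ (√d|x̂|)(√d|ŷ|) ≤ η √(Σ d|x̂|²) √(Σ d|ŷ|²)`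
  have h1 : ∑ ℓ ∈ S, ε ℓ * ‖mFourierCoeff (EuclideanSpace.complexify ∘ ⇑x) ℓ‖ * ‖mFourierCoeff (EuclideanSpace.complexify ∘ ⇑y) ℓ‖
      ≤ η * ∑ ℓ ∈ S, (Real.sqrt (d ℓ) * ‖mFourierCoeff (EuclideanSpace.complexify ∘ ⇑x) ℓ‖)
          * (Real.sqrt (d ℓ) * ‖mFourierCoeff (EuclideanSpace.complexify ∘ ⇑y) ℓ‖) := by
    rw [Finset.mul_sum]
    refine Finset.sum_le_sum fun ℓ hℓ => ?_
    have hdd : Real.sqrt (d ℓ) * Real.sqrt (d ℓ) = d ℓ := Real.mul_self_sqrt (hd0 ℓ)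
    have : η * (Real.sqrt (d ℓ) * ‖mFourierCoeff (EuclideanSpace.complexify ∘ ⇑x) ℓ‖ *
        (Real.sqrt (d ℓ) * ‖mFourierCoeff (EuclideanSpace.complexify ∘ ⇑y) ℓ‖))
        = (η * (Real.sqrt (d ℓ) * Real.sqrt (d ℓ))) * ‖mFourierCoeff (EuclideanSpace.complexify ∘ ⇑x) ℓ‖
            * ‖mFourierCoeff (EuclideanSpace.complexify ∘ ⇑y) ℓ‖ := by ring
    rw [this, hdd]
    exact mul_le_mul_of_nonneg_right (mul_le_mul_of_nonneg_right (hεd ℓ hℓ) (norm_nonneg _)) (norm_nonneg _)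
  refine h1.trans ?_
  rw [mul_assoc]
  refine mul_le_mul_of_nonneg_left ?_ hη
  have hcs := Real.sum_mul_le_sqrt_mul_sqrt S (fun ℓ => Real.sqrt (d ℓ) * ‖mFourierCoeff (EuclideanSpace.complexify ∘ ⇑x) ℓ‖)
    (fun ℓ => Real.sqrt (d ℓ) * ‖mFourierCoeff (EuclideanSpace.complexify ∘ ⇑y) ℓ‖)
  refine hcs.trans (le_of_eq ?_)
  congr 1 <;> (congr 1; refine Finset.sum_congr rfl fun ℓ _ => ?_; rw [mul_pow, Real.sq_sqrt (hd0 ℓ)])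

end Summit.AnomalousDissipation.AnomalousDissipation.Theorems.SolenoidalFractalHomogenisation.LagrangianStep.PropagatorSymm

end
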